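import Summits.ResolutionOfSingularities.ResolutionOfSingularities.Theorems.WeightedInvariantKeyRungThreeOfDropCurveSigma
import Summits.ResolutionOfSingularities.ResolutionOfSingularities.Theorems.WeightedInvariantSuccessorRatioBoundContact
import Summits.ResolutionOfSingularities.ResolutionOfSingularities.Theorems.WeightedInvariantIota3SigmaExtDimTwo
import HarnessLib

/-!
# (SIGMA) ⟸ two RATIO bounds: the flag-slope comparison at the pinned successor is a strict drop of the ratio letter `σ₁`, which follows
# from a successor ratio bound `r₁·q < r·r₂` upstairs and the transversal bound `ν!·r ≤ σ₁(S_P, f/1)·q` downstairs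
# (door `HypersurfaceCentreConstruction`, stmt-ResolutionOfSingularities-19897, stub `stub_keyRungGrHomLE_three`)

Helper for `stub_keyRungGrHomLE_three` (def-free, `--supports 19897`).  Sequel of this hand's gap list of record
`keyRungGrHomLE_three_of_tieDescent_point_sigma` (…KeyRungThreeOfDropCurveSigma: hD + (D-b³-point) + (SIGMA)), using res-L1-w43-idea-2's R9
arithmetic (`RatContact.sigmaRatioNat_mul_lt_of_slope_lt`, `RatContact.sigma_ratio_drop_of_bounds`, …SuccessorRatioBoundContact).

* **`Iota3.iotaSigma_lt_of_sigmaRatioNat_lt`** — a strict drop of the scaled ratio letter `σ₁ = sigmaRatioNat` is a drop of `σ = (σ₁ ; σ₂)`.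
* **`Iota3.adicOrder_toNat_eq_of_mem_of_not_mem`** — `ord g = ν` from `g ∈ 𝔪^ν ∖ 𝔪^{ν+1}` (bookkeeping for the `adicOrder`-indexed letters).
* **`Iota3.iotaSigma_lt_of_ratioBounds`** — for local positions `(L, g)`, `(A, f)` of the same order `ν` and `0 < q ≤ r`:
  `SuccessorRatioBound L g ν q (r − q)` («every admissible triple `(q'; r₁, r₂)` reached by `g` has `r₁·q < r·r₂`», i.e. NO flag of `L` reaches the
  slope `r/q`) and `ν!·r ≤ σ₁(f)·q` (the slope `r/q` IS reached at `(A, f)`, exactly) give `σ(L, g) < σ(A, f)`.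
* **`Iota3.iotaSigmaLevel_transversal_eq_omega0`** — at the centre the LEVEL letter is TOP: `σ₂(S_P, f/1) = ω` (`dim S_P = 2`,
  `iotaSigmaLevel_eq_omega0_of_ringKrullDim_eq_two`), recorded for the `σ₁`-tie branch (not needed below).
* **`keyRungGrHomLE_three_of_tieDescent_point_ratioBounds`** (GAP LIST, arithmetic form) and its (c11)-form
  **`keyRungGrHomLE_three_of_c11_point_ratioBounds`** — `KeyRungGrHomLE 3 p ⟸` hD (resp. (c11)≤3) + (D-b³-point) [the crux] +
  **(CURVE-RATIO)** «`ν!·r ≤ sigmaRatioNat (f/1 : S_P) · q`» [M: the AQS pair `(y/1, x/1; q; r, q)` reaches `r/q` by lex-maximality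
  (`I ≤ 𝒥_{rν}((y,x);(r,q))`, frame independence `RatContact.weightedMonomialIdeal_eq_ratContactFiltration`, dimension-two collapse), and the
  witness set is bounded by the lex-max clause] + **(SUCC-RATIO)** «`SuccessorRatioBound (B_𝔫) (g/1) ν q (r − q)`» [L–XL: tangent-cone dichotomy
  + `W`-led flags vs. AQS-tie-freeness, SIGMA-ISO.md §2 (b)] — both in hand -9's binders of (D-b³-curve-FRAC-TIE-ZERO).

[OURS · L1 W4.3 · audit glue; AI work, weaker than expert review; nothing here is a statement of the manuscript under review
(Hironaka 2017, [claim: Hironaka2017, status: under-review]).]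

## References

* D. Abramovich, M. Temkin, J. Włodarczyk, *Functorial embedded resolution via weighted blowings up*, Algebra & Number Theory 18 (2024), §5.
  [AbramovichTemkinWlodarczyk2024]
* H. Hironaka, *Characteristic polyhedra of singularities*, J. Math. Kyoto Univ. 7 (1967), §3. [Hironaka1967]
* res-L1-w43-idea-2, Sketch-R9 §5 (OURS; tree …SuccessorRatioBoundContact); hand -10, SIGMA-ISO.md (crux directory; OURS).
-/

noncomputable section

set_option linter.dupNamespace false -- mandated namespace of this single-conjunct summit

open IsLocalRing Literature.AlgebraicGeometry.Resolution
open Summit.ResolutionOfSingularities.ResolutionOfSingularities.Theorems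
open Summit.ResolutionOfSingularities.ResolutionOfSingularities.Theorems.ContactCylinder
open Summit.ResolutionOfSingularities.ResolutionOfSingularities.Cruxes.HypersurfaceCentreConstruction.LocalEngine.Iota3.RatContact

namespace Summit.ResolutionOfSingularities.ResolutionOfSingularities.Cruxes.HypersurfaceCentreConstruction.LocalEngine

namespace Iota3

/-! ## §1 A strict drop of the ratio letter is a drop of `σ` -/

/-- **A strict drop of `σ₁` is a drop of `σ = (σ₁ ; σ₂)`** (local rings; `σ₂ ≤ ω < ω + 1`). [OURS · L1 W4.3] -/
theorem iotaSigma_lt_of_sigmaRatioNat_lt {L A : Type} [CommRing L] [IsLocalRing L] [CommRing A] [IsLocalRing A] {g : L} {f : A}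
    (h : sigmaRatioNat g < sigmaRatioNat f) : iotaSigma L g < iotaSigma A f := by
  change iotaLex (Ordinal.omega0 + 1) iotaSigmaRatio iotaSigmaLevel L g < iotaLex (Ordinal.omega0 + 1) iotaSigmaRatio iotaSigmaLevel A f
  rw [iotaLex_lt_iff iotaSigmaLevel_boundedBy, iotaSigmaRatio_eq, iotaSigmaRatio_eq]
  exact Or.inl (by exact_mod_cast h)

/-- `ord g = ν` (as the natural number `(adicOrder g).toNat`) from `g ∈ 𝔪^ν ∖ 𝔪^{ν+1}`. [folklore] -/
theorem adicOrder_toNat_eq_of_mem_of_not_mem {R : Type} [CommRing R] [IsLocalRing R] {g : R} {ν : ℕ} (h1 : g ∈ maximalIdeal R ^ ν)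
    (h2 : g ∉ maximalIdeal R ^ (ν + 1)) : (adicOrder g).toNat = ν := by
  have h : adicOrder g = (ν : ℕ∞) := le_antisymm ((adicOrder_le_iff g ν).mpr h2) ((le_adicOrder_iff g ν).mpr h1)
  rw [h, ENat.toNat_coe]

/-- **(SIGMA) ⟸ two RATIO bounds**: for local positions `(L, g)` and `(A, f)` of the same order `ν` (`g ∈ 𝔪_L^ν ∖ 𝔪_L^{ν+1}`,
`f ∈ 𝔪_A^ν ∖ 𝔪_A^{ν+1}`) and `0 < q ≤ r`: if NO flag of `L` reaches the slope `r/q` for `g` (`SuccessorRatioBound L g ν q (r − q)`: every admissible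
reached triple has `r₁·q < r·r₂`) while the slope `r/q` IS reached, exactly, at `(A, f)` (`ν!·r ≤ σ₁(f)·q`), then `σ(L, g) < σ(A, f)`.
[OURS · L1 W4.3 · R9 arithmetic] [cite: AbramovichTemkinWlodarczyk2024, §5] -/
theorem iotaSigma_lt_of_ratioBounds {L A : Type} [CommRing L] [IsLocalRing L] [CommRing A] [IsLocalRing A] {g : L} {f : A}
    {ν q r : ℕ} (hq : 0 < q) (hqr : q ≤ r) (hgν : g ∈ maximalIdeal L ^ ν) (hgν1 : g ∉ maximalIdeal L ^ (ν + 1))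
    (hfν : f ∈ maximalIdeal A ^ ν) (hfν1 : f ∉ maximalIdeal A ^ (ν + 1))
    (hsucc : SuccessorRatioBound L g ν q (r - q)) (hcurve : ratioScale ν * r ≤ sigmaRatioNat f * q) :
    iotaSigma L g < iotaSigma A f := by
  have hνg : (adicOrder g).toNat = ν := adicOrder_toNat_eq_of_mem_of_not_mem hgν hgν1
  have h1 := sigmaRatioNat_mul_lt_of_slope_lt g hq (ρ := r - q) (by rw [hνg]; exact hsucc)
  rw [hνg] at h1
  have _hνf : (adicOrder f).toNat = ν := adicOrder_toNat_eq_of_mem_of_not_mem hfν hfν1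
  exact iotaSigma_lt_of_sigmaRatioNat_lt (sigma_ratio_drop_of_bounds h1 (by omega) hcurve)

/-- **At the centre the LEVEL letter is TOP**: for `S` regular local of Krull dimension `3` and a prime `P ≠ 𝔪` with `¬ dim S_P ≤ 1` (a curve centre),
`iotaSigmaLevel (S_P) (f/1) = ω` (`dim S_P = 2`: every two-flag generates `𝔪`, reached triples rescale, the level set is empty or unbounded).
[OURS · L1 W4.3] [cite: Hironaka1967, §3] -/
theorem iotaSigmaLevel_transversal_eq_omega0 {S : Type} [CommRing S] [IsRegularLocalRing S] (hd : ringKrullDim S = 3) (P : Ideal S)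
    [P.IsPrime] (hP1 : ¬ ringKrullDim (Localization.AtPrime P) ≤ 1) (hPm : P ≠ maximalIdeal S) (f : S) :
    iotaSigmaLevel (Localization.AtPrime P) (algebraMap S (Localization.AtPrime P) f) = Ordinal.omega0 :=
  iotaSigmaLevel_eq_omega0_of_ringKrullDim_eq_two (ringKrullDim_localization_eq_two_of_curveCentre hd P hP1 hPm) _

/-! ## §2 (SIGMA) from the two ratio bounds, in the binders of the door; the gap list in arithmetic form -/

/-- **(SIGMA) ⟸ (CURVE-RATIO) + (SUCC-RATIO)**, verbatim binders of hand -9's clause: at the pinned successor the `σ`-comparison follows from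
`ν!·r ≤ σ₁(S_P, f/1)·q` and `SuccessorRatioBound (B_𝔫) (g/1) ν q (r − q)` (the orders agree: `ord g/1 = ν = ord f/1`). [OURS · L1 W4.3] -/
theorem curveSigma_of_ratioBounds (p : ℕ)
    (hCURVE : ∀ (k₀ : Type) [Field k₀] [CharP k₀ p] [PerfectField k₀]
      (S : Type) [CommRing S] [Algebra k₀ S] [Algebra.EssFiniteType k₀ S] [IsRegularLocalRing S]
      (f : S), ringKrullDim S = 3 → f ≠ 0 → f ∈ (maximalIdeal S) ^ 2 →
      ∀ (P : Ideal S) [P.IsPrime], IsRegularLocalRing (S ⧸ P) → f ∈ P →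
        topStratum iotaOrdEpsTau S f = {𝔮 | P ≤ 𝔮.asIdeal} → ¬ ringKrullDim (Localization.AtPrime P) ≤ 1 →
        P ≠ maximalIdeal S →
        ∀ (x y z : S) (q r ν : ℕ) (_ : (Ideal.span ({x, y} : Set S)).IsPrime), Ideal.span {x, y, z} = maximalIdeal S →
          P = Ideal.span {x, y} → 2 ≤ q → q ≤ r → 1 ≤ ν → f ∈ maximalIdeal S ^ ν → f ∉ maximalIdeal S ^ (ν + 1) →
          IsLexMaxWeightedCentreGerm (Localization.AtPrime (Ideal.span ({x, y} : Set S)))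
            (Ideal.span {algebraMap S (Localization.AtPrime (Ideal.span ({x, y} : Set S))) f})
            ![algebraMap S (Localization.AtPrime (Ideal.span ({x, y} : Set S))) y,
              algebraMap S (Localization.AtPrime (Ideal.span ({x, y} : Set S))) x] ![r, q] (r * ν) →
          ratioScale ν * r ≤ sigmaRatioNat (algebraMap S (Localization.AtPrime P) f) * q)
    (hSUCC : ∀ (k₀ : Type) [Field k₀] [CharP k₀ p] [PerfectField k₀]
      (S : Type) [CommRing S] [Algebra k₀ S] [Algebra.EssFiniteType k₀ S] [IsRegularLocalRing S]
      (f : S), ringKrullDim S = 3 → f ≠ 0 → f ∈ (maximalIdeal S) ^ 2 →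
      ∀ (P : Ideal S) [P.IsPrime], IsRegularLocalRing (S ⧸ P) → f ∈ P →
        topStratum iotaOrdEpsTau S f = {𝔮 | P ≤ 𝔮.asIdeal} → ¬ ringKrullDim (Localization.AtPrime P) ≤ 1 →
        P ≠ maximalIdeal S →
        ∀ (x y z : S) (q r ν : ℕ) (_ : (Ideal.span ({x, y} : Set S)).IsPrime), Ideal.span {x, y, z} = maximalIdeal S →
          P = Ideal.span {x, y} → 2 ≤ q → q ≤ r → 1 ≤ ν → f ∈ maximalIdeal S ^ ν → f ∉ maximalIdeal S ^ (ν + 1) →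
          IsLexMaxWeightedCentreGerm (Localization.AtPrime (Ideal.span ({x, y} : Set S)))
            (Ideal.span {algebraMap S (Localization.AtPrime (Ideal.span ({x, y} : Set S))) f})
            ![algebraMap S (Localization.AtPrime (Ideal.span ({x, y} : Set S))) y,
              algebraMap S (Localization.AtPrime (Ideal.span ({x, y} : Set S))) x] ![r, q] (r * ν) →
          1 ≤ r / q → f ∈ weightedMonomialIdeal ![y, x] ![r / q, 1] (r / q * ν) →
          (∀ m : ℕ, jFlatT S f m = weightedMonomialIdeal ![y, x] ![r / q, 1] m) →
        ∀ (n : ℕ) (u : Fin n → S) (w : Fin n → ℕ),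
          Ideal.span (Set.range u) = maximalIdeal S → (maximalIdeal S).spanFinrank = n → (∃ i, 0 < w i) →
          Ideal.span {x | ∃ i, 0 < w i ∧ x = u i} = P →
          (∀ m : ℕ, weightedMonomialIdeal u w m = jFlatT S f m) →
          ∀ (𝔫 : Ideal (cobordantAlgebra' u w)) [𝔫.IsPrime], IsTHomogeneous u w 𝔫 → cobordantT' u w ∈ 𝔫 →
            (maximalIdeal S).map (algebraMap S (cobordantAlgebra' u w)) ≤ 𝔫 →
            ¬ extReesAlgebra.vertexIdeal (weightedMonomialIdeal u w) ≤ 𝔫 →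
            ∀ (a : ℕ) (g : cobordantAlgebra' u w), algebraMap S (cobordantAlgebra' u w) f = cobordantT' u w ^ a * g →
              ¬ cobordantT' u w ∣ g →
              algebraMap (cobordantAlgebra' u w) (Localization.AtPrime 𝔫) g ∈ maximalIdeal (Localization.AtPrime 𝔫) ^ 2 →
              f ∈ weightedMonomialIdeal ![x, y, z] ![1, r / q + 1, 1] ((r / q + 1) * ν) →
              ∀ W : cobordantAlgebra' u w, algebraMap S (cobordantAlgebra' u w) y = cobordantT' u w ^ (r / q) * W →
                𝔫 = Ideal.span {cobordantT' u w, algebraMap S (cobordantAlgebra' u w) z, W} →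
                IsRegularLocalRing (Localization.AtPrime 𝔫) → ringKrullDim (Localization.AtPrime 𝔫) = (3 : ℕ) →
                Ideal.span {algebraMap _ (Localization.AtPrime 𝔫) (cobordantT' u w),
                  algebraMap _ (Localization.AtPrime 𝔫) (algebraMap S (cobordantAlgebra' u w) z),
                  algebraMap _ (Localization.AtPrime 𝔫) W} = maximalIdeal (Localization.AtPrime 𝔫) →
              SuccessorRatioBound (Localization.AtPrime 𝔫) (algebraMap (cobordantAlgebra' u w) (Localization.AtPrime 𝔫) g) ν q (r - q)) :
    ∀ (k₀ : Type) [Field k₀] [CharP k₀ p] [PerfectField k₀]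
      (S : Type) [CommRing S] [Algebra k₀ S] [Algebra.EssFiniteType k₀ S] [IsRegularLocalRing S]
      (f : S), ringKrullDim S = 3 → f ≠ 0 → f ∈ (maximalIdeal S) ^ 2 →
      ∀ (P : Ideal S) [P.IsPrime], IsRegularLocalRing (S ⧸ P) → f ∈ P →
        topStratum iotaOrdEpsTau S f = {𝔮 | P ≤ 𝔮.asIdeal} → ¬ ringKrullDim (Localization.AtPrime P) ≤ 1 →
        P ≠ maximalIdeal S →
        ∀ (x y z : S) (q r ν : ℕ) (_ : (Ideal.span ({x, y} : Set S)).IsPrime), Ideal.span {x, y, z} = maximalIdeal S →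
          P = Ideal.span {x, y} → 2 ≤ q → q ≤ r → 1 ≤ ν → f ∈ maximalIdeal S ^ ν → f ∉ maximalIdeal S ^ (ν + 1) →
          IsLexMaxWeightedCentreGerm (Localization.AtPrime (Ideal.span ({x, y} : Set S)))
            (Ideal.span {algebraMap S (Localization.AtPrime (Ideal.span ({x, y} : Set S))) f})
            ![algebraMap S (Localization.AtPrime (Ideal.span ({x, y} : Set S))) y,
              algebraMap S (Localization.AtPrime (Ideal.span ({x, y} : Set S))) x] ![r, q] (r * ν) →
          1 ≤ r / q → f ∈ weightedMonomialIdeal ![y, x] ![r / q, 1] (r / q * ν) →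
          (∀ m : ℕ, jFlatT S f m = weightedMonomialIdeal ![y, x] ![r / q, 1] m) →
        ∀ (n : ℕ) (u : Fin n → S) (w : Fin n → ℕ),
          Ideal.span (Set.range u) = maximalIdeal S → (maximalIdeal S).spanFinrank = n → (∃ i, 0 < w i) →
          Ideal.span {x | ∃ i, 0 < w i ∧ x = u i} = P →
          (∀ m : ℕ, weightedMonomialIdeal u w m = jFlatT S f m) →
          ∀ (𝔫 : Ideal (cobordantAlgebra' u w)) [𝔫.IsPrime], IsTHomogeneous u w 𝔫 → cobordantT' u w ∈ 𝔫 →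
            (maximalIdeal S).map (algebraMap S (cobordantAlgebra' u w)) ≤ 𝔫 →
            ¬ extReesAlgebra.vertexIdeal (weightedMonomialIdeal u w) ≤ 𝔫 →
            ∀ (a : ℕ) (g : cobordantAlgebra' u w), algebraMap S (cobordantAlgebra' u w) f = cobordantT' u w ^ a * g →
              ¬ cobordantT' u w ∣ g →
              algebraMap (cobordantAlgebra' u w) (Localization.AtPrime 𝔫) g ∈ maximalIdeal (Localization.AtPrime 𝔫) ^ 2 →
              f ∈ weightedMonomialIdeal ![x, y, z] ![1, r / q + 1, 1] ((r / q + 1) * ν) →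
              ∀ W : cobordantAlgebra' u w, algebraMap S (cobordantAlgebra' u w) y = cobordantT' u w ^ (r / q) * W →
                𝔫 = Ideal.span {cobordantT' u w, algebraMap S (cobordantAlgebra' u w) z, W} →
                IsRegularLocalRing (Localization.AtPrime 𝔫) → ringKrullDim (Localization.AtPrime 𝔫) = (3 : ℕ) →
                Ideal.span {algebraMap _ (Localization.AtPrime 𝔫) (cobordantT' u w),
                  algebraMap _ (Localization.AtPrime 𝔫) (algebraMap S (cobordantAlgebra' u w) z),
                  algebraMap _ (Localization.AtPrime 𝔫) W} = maximalIdeal (Localization.AtPrime 𝔫) →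
              iotaSigma (Localization.AtPrime 𝔫) (algebraMap (cobordantAlgebra' u w) (Localization.AtPrime 𝔫) g) <
                iotaSigma (Localization.AtPrime P) (algebraMap S (Localization.AtPrime P) f) := by
  intro k₀ _ _ _ S _ _ _ _ f hd hf0 hf2 P _ hreg hfP hE hP1 hPm x y z q r ν hPxy hxyz hPeq hq2 hqr hν1 hfν hfν1 hlex hb1 hadm hJ
    n u w h1 h2 h3 h4 h5 𝔫 _ hhom hT hM hV a g hfg hTg hg2 hft0 W hW h𝔫 hR1 hR2 hR3
  classical
  haveI := hR1
  have hd3 : ringKrullDim S = (3 : ℕ) := by rw [hd]; rfl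
  have hrk : (maximalIdeal S).spanFinrank = 3 := by
    have h := IsRegularLocalRing.spanFinrank_maximalIdeal (R := S)
    rw [hd3] at h
    exact_mod_cast h
  have hyxz : Ideal.span (Set.range ![y, x, z]) = maximalIdeal S := by rw [range_three, Set.insert_comm]; exact hxyz
  -- the AQS-adapted normal form `f = c y^ν + h`
  obtain ⟨_, hlex'⟩ := exists_isLexMax_of_eq hPeq.symm hlex
  have hcop' : Nat.Coprime r q := by simpa using hlex'.2.2.1
  have hndvd : ¬ q ∣ r := fun hdvd => by
    have h1 : Nat.gcd r q = 1 := hcop'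
    rw [Nat.gcd_eq_right hdvd] at h1
    omega
  have hsup := mem_span_pow_sup_of_curve_lexMax_frac hd P hPeq.symm hxyz hν1 hndvd hlex'
  obtain ⟨c, h, hc, hh, hf⟩ := exists_normalForm_of_mem_sup hyxz hb1 hsup hfν1
  have hpres : ∀ m : ℕ, weightedMonomialIdeal u w m = weightedMonomialIdeal ![y, x] ![r / q, 1] m := fun m => by rw [h5 m, hJ m]
  -- the orders: `ord g/1 = ν = ord f/1`
  have hgν : algebraMap (cobordantAlgebra' u w) (Localization.AtPrime 𝔫) g ∈ maximalIdeal (Localization.AtPrime 𝔫) ^ ν :=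
    transform_mem_pow_of_mem_tieZero hyxz hrk Nat.one_pos hb1 hfν1 hadm hft0 u w hpres 𝔫 hM W hW h𝔫 hR1 hR2 hR3 hfg hTg
  have hgν1 : algebraMap (cobordantAlgebra' u w) (Localization.AtPrime 𝔫) g ∉ maximalIdeal (Localization.AtPrime 𝔫) ^ (ν + 1) :=
    transform_not_mem_pow_succ_of_normalForm hyxz hrk Nat.one_pos hb1 hfν1 hadm hc hh hf u w hpres 𝔫 W hW hR1 hR2 hR3 hfg hTg
  have hιP : iotaOrd (Localization.AtPrime P) (algebraMap S (Localization.AtPrime P) f) = iotaOrd S f := by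
    have hmem : (⟨P, ‹_›⟩ : PrimeSpectrum S) ∈ topStratum iotaOrdEpsTau S f := by
      rw [hE]
      exact (le_rfl : P ≤ P)
    have h0 : iotaOrdEpsTau (Localization.AtPrime P) (algebraMap S (Localization.AtPrime P) f) = iotaOrdEpsTau S f := hmem
    exact ((iotaOrdEps_eq_iff _ _ _ _).mp ((iotaOrdEpsTau_eq_iff _ _ _ _).mp h0).1).1
  rw [(iotaOrd_eq_natCast_iff S f ν).mpr ⟨hfν, hfν1⟩] at hιP
  obtain ⟨hfPν, hfPν1⟩ := (iotaOrd_eq_natCast_iff (Localization.AtPrime P) (algebraMap S (Localization.AtPrime P) f) ν).mp hιP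
  exact iotaSigma_lt_of_ratioBounds (by omega) hqr hgν hgν1 hfPν hfPν1
    (hSUCC k₀ S f hd hf0 hf2 P hreg hfP hE hP1 hPm x y z q r ν hPxy hxyz hPeq hq2 hqr hν1 hfν hfν1 hlex hb1 hadm hJ n u w h1 h2 h3 h4 h5 𝔫
      hhom hT hM hV a g hfg hTg hg2 hft0 W hW h𝔫 hR1 hR2 hR3)
    (hCURVE k₀ S f hd hf0 hf2 P hreg hfP hE hP1 hPm x y z q r ν hPxy hxyz hPeq hq2 hqr hν1 hfν hfν1 hlex)


end Iota3

open Iota3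

/-- **GAP LIST OF RECORD, arithmetic form — hD + (D-b³-point) + (CURVE-RATIO) + (SUCC-RATIO)** (module docstring): the curve regime of (D-b³)
costs the transversal exactness `ν!·r ≤ σ₁(S_P, f/1)·q` [M] and the successor ratio bound «no two-flag of `B_𝔫` reaches the slope `r/q` for `g/1`»
[L–XL] at the pinned regular local threefold. [OURS · L1 W4.3 · audit glue] -/
theorem keyRungGrHomLE_three_of_tieDescent_point_ratioBounds (p : ℕ)
    (hD : ∀ (T T' : Type) [CommRing T] [IsRegularLocalRing T] [CommRing T'] [IsRegularLocalRing T'] [Algebra T T']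
      [IsLocalHom (algebraMap T T')] [Algebra.FormallySmooth T T'] [Algebra.EssFiniteType T T'] (g : T),
      ringKrullDim T' ≤ 3 → IsTiePosition T' (algebraMap T T' g) → IsTiePosition T g)
    (hPOINT : ∀ (k₀ : Type) [Field k₀] [CharP k₀ p] [PerfectField k₀]
      (S : Type) [CommRing S] [Algebra k₀ S] [Algebra.EssFiniteType k₀ S] [IsRegularLocalRing S]
      (f : S), ringKrullDim S = 3 → f ≠ 0 → f ∈ (maximalIdeal S) ^ 2 →
      ∀ (P : Ideal S) [P.IsPrime], IsRegularLocalRing (S ⧸ P) → f ∈ P →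
        topStratum iotaOrdEpsTau S f = {𝔮 | P ≤ 𝔮.asIdeal} → ¬ ringKrullDim (Localization.AtPrime P) ≤ 1 →
        P = maximalIdeal S →
        ∀ (n : ℕ) (u : Fin n → S) (w : Fin n → ℕ),
          Ideal.span (Set.range u) = maximalIdeal S → (maximalIdeal S).spanFinrank = n → (∃ i, 0 < w i) →
          Ideal.span {x | ∃ i, 0 < w i ∧ x = u i} = P →
          (∀ m : ℕ, weightedMonomialIdeal u w m = jFlatT S f m) →
          ∀ (𝔫 : Ideal (cobordantAlgebra' u w)) [𝔫.IsPrime], IsTHomogeneous u w 𝔫 → cobordantT' u w ∈ 𝔫 →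
            (maximalIdeal S).map (algebraMap S (cobordantAlgebra' u w)) ≤ 𝔫 →
            ¬ extReesAlgebra.vertexIdeal (weightedMonomialIdeal u w) ≤ 𝔫 →
            ∀ (a : ℕ) (g : cobordantAlgebra' u w), algebraMap S (cobordantAlgebra' u w) f = cobordantT' u w ^ a * g →
              ¬ cobordantT' u w ∣ g →
              algebraMap (cobordantAlgebra' u w) (Localization.AtPrime 𝔫) g ∈ maximalIdeal (Localization.AtPrime 𝔫) ^ 2 →
              iotaFlatT (Localization.AtPrime 𝔫) (algebraMap (cobordantAlgebra' u w) (Localization.AtPrime 𝔫) g) <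
                iotaFlatT S f)
    (hCURVE : ∀ (k₀ : Type) [Field k₀] [CharP k₀ p] [PerfectField k₀]
      (S : Type) [CommRing S] [Algebra k₀ S] [Algebra.EssFiniteType k₀ S] [IsRegularLocalRing S]
      (f : S), ringKrullDim S = 3 → f ≠ 0 → f ∈ (maximalIdeal S) ^ 2 →
      ∀ (P : Ideal S) [P.IsPrime], IsRegularLocalRing (S ⧸ P) → f ∈ P →
        topStratum iotaOrdEpsTau S f = {𝔮 | P ≤ 𝔮.asIdeal} → ¬ ringKrullDim (Localization.AtPrime P) ≤ 1 →
        P ≠ maximalIdeal S →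
        ∀ (x y z : S) (q r ν : ℕ) (_ : (Ideal.span ({x, y} : Set S)).IsPrime), Ideal.span {x, y, z} = maximalIdeal S →
          P = Ideal.span {x, y} → 2 ≤ q → q ≤ r → 1 ≤ ν → f ∈ maximalIdeal S ^ ν → f ∉ maximalIdeal S ^ (ν + 1) →
          IsLexMaxWeightedCentreGerm (Localization.AtPrime (Ideal.span ({x, y} : Set S)))
            (Ideal.span {algebraMap S (Localization.AtPrime (Ideal.span ({x, y} : Set S))) f})
            ![algebraMap S (Localization.AtPrime (Ideal.span ({x, y} : Set S))) y,
              algebraMap S (Localization.AtPrime (Ideal.span ({x, y} : Set S))) x] ![r, q] (r * ν) →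
          ratioScale ν * r ≤ sigmaRatioNat (algebraMap S (Localization.AtPrime P) f) * q)
    (hSUCC : ∀ (k₀ : Type) [Field k₀] [CharP k₀ p] [PerfectField k₀]
      (S : Type) [CommRing S] [Algebra k₀ S] [Algebra.EssFiniteType k₀ S] [IsRegularLocalRing S]
      (f : S), ringKrullDim S = 3 → f ≠ 0 → f ∈ (maximalIdeal S) ^ 2 →
      ∀ (P : Ideal S) [P.IsPrime], IsRegularLocalRing (S ⧸ P) → f ∈ P →
        topStratum iotaOrdEpsTau S f = {𝔮 | P ≤ 𝔮.asIdeal} → ¬ ringKrullDim (Localization.AtPrime P) ≤ 1 →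
        P ≠ maximalIdeal S →
        ∀ (x y z : S) (q r ν : ℕ) (_ : (Ideal.span ({x, y} : Set S)).IsPrime), Ideal.span {x, y, z} = maximalIdeal S →
          P = Ideal.span {x, y} → 2 ≤ q → q ≤ r → 1 ≤ ν → f ∈ maximalIdeal S ^ ν → f ∉ maximalIdeal S ^ (ν + 1) →
          IsLexMaxWeightedCentreGerm (Localization.AtPrime (Ideal.span ({x, y} : Set S)))
            (Ideal.span {algebraMap S (Localization.AtPrime (Ideal.span ({x, y} : Set S))) f})
            ![algebraMap S (Localization.AtPrime (Ideal.span ({x, y} : Set S))) y,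
              algebraMap S (Localization.AtPrime (Ideal.span ({x, y} : Set S))) x] ![r, q] (r * ν) →
          1 ≤ r / q → f ∈ weightedMonomialIdeal ![y, x] ![r / q, 1] (r / q * ν) →
          (∀ m : ℕ, jFlatT S f m = weightedMonomialIdeal ![y, x] ![r / q, 1] m) →
        ∀ (n : ℕ) (u : Fin n → S) (w : Fin n → ℕ),
          Ideal.span (Set.range u) = maximalIdeal S → (maximalIdeal S).spanFinrank = n → (∃ i, 0 < w i) →
          Ideal.span {x | ∃ i, 0 < w i ∧ x = u i} = P →
          (∀ m : ℕ, weightedMonomialIdeal u w m = jFlatT S f m) →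
          ∀ (𝔫 : Ideal (cobordantAlgebra' u w)) [𝔫.IsPrime], IsTHomogeneous u w 𝔫 → cobordantT' u w ∈ 𝔫 →
            (maximalIdeal S).map (algebraMap S (cobordantAlgebra' u w)) ≤ 𝔫 →
            ¬ extReesAlgebra.vertexIdeal (weightedMonomialIdeal u w) ≤ 𝔫 →
            ∀ (a : ℕ) (g : cobordantAlgebra' u w), algebraMap S (cobordantAlgebra' u w) f = cobordantT' u w ^ a * g →
              ¬ cobordantT' u w ∣ g →
              algebraMap (cobordantAlgebra' u w) (Localization.AtPrime 𝔫) g ∈ maximalIdeal (Localization.AtPrime 𝔫) ^ 2 →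
              f ∈ weightedMonomialIdeal ![x, y, z] ![1, r / q + 1, 1] ((r / q + 1) * ν) →
              ∀ W : cobordantAlgebra' u w, algebraMap S (cobordantAlgebra' u w) y = cobordantT' u w ^ (r / q) * W →
                𝔫 = Ideal.span {cobordantT' u w, algebraMap S (cobordantAlgebra' u w) z, W} →
                IsRegularLocalRing (Localization.AtPrime 𝔫) → ringKrullDim (Localization.AtPrime 𝔫) = (3 : ℕ) →
                Ideal.span {algebraMap _ (Localization.AtPrime 𝔫) (cobordantT' u w),
                  algebraMap _ (Localization.AtPrime 𝔫) (algebraMap S (cobordantAlgebra' u w) z),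
                  algebraMap _ (Localization.AtPrime 𝔫) W} = maximalIdeal (Localization.AtPrime 𝔫) →
              SuccessorRatioBound (Localization.AtPrime 𝔫) (algebraMap (cobordantAlgebra' u w) (Localization.AtPrime 𝔫) g) ν q (r - q))
    : KeyRungGrHomLE 3 p :=
  keyRungGrHomLE_three_of_tieDescent_point_sigma p hD hPOINT (curveSigma_of_ratioBounds p hCURVE hSUCC)

/-- **GAP LIST OF RECORD, arithmetic (c11)-form — (c11)≤3 + (D-b³-point) + (CURVE-RATIO) + (SUCC-RATIO).** [OURS · L1 W4.3 · audit glue] -/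
theorem keyRungGrHomLE_three_of_c11_point_ratioBounds (p : ℕ) (hc11 : IotaJEssSmoothCompatibleLE 3 iotaFlatT jFlatT)
    (hPOINT : ∀ (k₀ : Type) [Field k₀] [CharP k₀ p] [PerfectField k₀]
      (S : Type) [CommRing S] [Algebra k₀ S] [Algebra.EssFiniteType k₀ S] [IsRegularLocalRing S]
      (f : S), ringKrullDim S = 3 → f ≠ 0 → f ∈ (maximalIdeal S) ^ 2 →
      ∀ (P : Ideal S) [P.IsPrime], IsRegularLocalRing (S ⧸ P) → f ∈ P →
        topStratum iotaOrdEpsTau S f = {𝔮 | P ≤ 𝔮.asIdeal} → ¬ ringKrullDim (Localization.AtPrime P) ≤ 1 →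
        P = maximalIdeal S →
        ∀ (n : ℕ) (u : Fin n → S) (w : Fin n → ℕ),
          Ideal.span (Set.range u) = maximalIdeal S → (maximalIdeal S).spanFinrank = n → (∃ i, 0 < w i) →
          Ideal.span {x | ∃ i, 0 < w i ∧ x = u i} = P →
          (∀ m : ℕ, weightedMonomialIdeal u w m = jFlatT S f m) →
          ∀ (𝔫 : Ideal (cobordantAlgebra' u w)) [𝔫.IsPrime], IsTHomogeneous u w 𝔫 → cobordantT' u w ∈ 𝔫 →
            (maximalIdeal S).map (algebraMap S (cobordantAlgebra' u w)) ≤ 𝔫 →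
            ¬ extReesAlgebra.vertexIdeal (weightedMonomialIdeal u w) ≤ 𝔫 →
            ∀ (a : ℕ) (g : cobordantAlgebra' u w), algebraMap S (cobordantAlgebra' u w) f = cobordantT' u w ^ a * g →
              ¬ cobordantT' u w ∣ g →
              algebraMap (cobordantAlgebra' u w) (Localization.AtPrime 𝔫) g ∈ maximalIdeal (Localization.AtPrime 𝔫) ^ 2 →
              iotaFlatT (Localization.AtPrime 𝔫) (algebraMap (cobordantAlgebra' u w) (Localization.AtPrime 𝔫) g) <
                iotaFlatT S f)
    (hCURVE : ∀ (k₀ : Type) [Field k₀] [CharP k₀ p] [PerfectField k₀]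
      (S : Type) [CommRing S] [Algebra k₀ S] [Algebra.EssFiniteType k₀ S] [IsRegularLocalRing S]
      (f : S), ringKrullDim S = 3 → f ≠ 0 → f ∈ (maximalIdeal S) ^ 2 →
      ∀ (P : Ideal S) [P.IsPrime], IsRegularLocalRing (S ⧸ P) → f ∈ P →
        topStratum iotaOrdEpsTau S f = {𝔮 | P ≤ 𝔮.asIdeal} → ¬ ringKrullDim (Localization.AtPrime P) ≤ 1 →
        P ≠ maximalIdeal S →
        ∀ (x y z : S) (q r ν : ℕ) (_ : (Ideal.span ({x, y} : Set S)).IsPrime), Ideal.span {x, y, z} = maximalIdeal S →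
          P = Ideal.span {x, y} → 2 ≤ q → q ≤ r → 1 ≤ ν → f ∈ maximalIdeal S ^ ν → f ∉ maximalIdeal S ^ (ν + 1) →
          IsLexMaxWeightedCentreGerm (Localization.AtPrime (Ideal.span ({x, y} : Set S)))
            (Ideal.span {algebraMap S (Localization.AtPrime (Ideal.span ({x, y} : Set S))) f})
            ![algebraMap S (Localization.AtPrime (Ideal.span ({x, y} : Set S))) y,
              algebraMap S (Localization.AtPrime (Ideal.span ({x, y} : Set S))) x] ![r, q] (r * ν) →
          ratioScale ν * r ≤ sigmaRatioNat (algebraMap S (Localization.AtPrime P) f) * q)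
    (hSUCC : ∀ (k₀ : Type) [Field k₀] [CharP k₀ p] [PerfectField k₀]
      (S : Type) [CommRing S] [Algebra k₀ S] [Algebra.EssFiniteType k₀ S] [IsRegularLocalRing S]
      (f : S), ringKrullDim S = 3 → f ≠ 0 → f ∈ (maximalIdeal S) ^ 2 →
      ∀ (P : Ideal S) [P.IsPrime], IsRegularLocalRing (S ⧸ P) → f ∈ P →
        topStratum iotaOrdEpsTau S f = {𝔮 | P ≤ 𝔮.asIdeal} → ¬ ringKrullDim (Localization.AtPrime P) ≤ 1 →
        P ≠ maximalIdeal S →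
        ∀ (x y z : S) (q r ν : ℕ) (_ : (Ideal.span ({x, y} : Set S)).IsPrime), Ideal.span {x, y, z} = maximalIdeal S →
          P = Ideal.span {x, y} → 2 ≤ q → q ≤ r → 1 ≤ ν → f ∈ maximalIdeal S ^ ν → f ∉ maximalIdeal S ^ (ν + 1) →
          IsLexMaxWeightedCentreGerm (Localization.AtPrime (Ideal.span ({x, y} : Set S)))
            (Ideal.span {algebraMap S (Localization.AtPrime (Ideal.span ({x, y} : Set S))) f})
            ![algebraMap S (Localization.AtPrime (Ideal.span ({x, y} : Set S))) y,
              algebraMap S (Localization.AtPrime (Ideal.span ({x, y} : Set S))) x] ![r, q] (r * ν) →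
          1 ≤ r / q → f ∈ weightedMonomialIdeal ![y, x] ![r / q, 1] (r / q * ν) →
          (∀ m : ℕ, jFlatT S f m = weightedMonomialIdeal ![y, x] ![r / q, 1] m) →
        ∀ (n : ℕ) (u : Fin n → S) (w : Fin n → ℕ),
          Ideal.span (Set.range u) = maximalIdeal S → (maximalIdeal S).spanFinrank = n → (∃ i, 0 < w i) →
          Ideal.span {x | ∃ i, 0 < w i ∧ x = u i} = P →
          (∀ m : ℕ, weightedMonomialIdeal u w m = jFlatT S f m) →
          ∀ (𝔫 : Ideal (cobordantAlgebra' u w)) [𝔫.IsPrime], IsTHomogeneous u w 𝔫 → cobordantT' u w ∈ 𝔫 →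
            (maximalIdeal S).map (algebraMap S (cobordantAlgebra' u w)) ≤ 𝔫 →
            ¬ extReesAlgebra.vertexIdeal (weightedMonomialIdeal u w) ≤ 𝔫 →
            ∀ (a : ℕ) (g : cobordantAlgebra' u w), algebraMap S (cobordantAlgebra' u w) f = cobordantT' u w ^ a * g →
              ¬ cobordantT' u w ∣ g →
              algebraMap (cobordantAlgebra' u w) (Localization.AtPrime 𝔫) g ∈ maximalIdeal (Localization.AtPrime 𝔫) ^ 2 →
              f ∈ weightedMonomialIdeal ![x, y, z] ![1, r / q + 1, 1] ((r / q + 1) * ν) →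
              ∀ W : cobordantAlgebra' u w, algebraMap S (cobordantAlgebra' u w) y = cobordantT' u w ^ (r / q) * W →
                𝔫 = Ideal.span {cobordantT' u w, algebraMap S (cobordantAlgebra' u w) z, W} →
                IsRegularLocalRing (Localization.AtPrime 𝔫) → ringKrullDim (Localization.AtPrime 𝔫) = (3 : ℕ) →
                Ideal.span {algebraMap _ (Localization.AtPrime 𝔫) (cobordantT' u w),
                  algebraMap _ (Localization.AtPrime 𝔫) (algebraMap S (cobordantAlgebra' u w) z),
                  algebraMap _ (Localization.AtPrime 𝔫) W} = maximalIdeal (Localization.AtPrime 𝔫) →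
              SuccessorRatioBound (Localization.AtPrime 𝔫) (algebraMap (cobordantAlgebra' u w) (Localization.AtPrime 𝔫) g) ν q (r - q))
    : KeyRungGrHomLE 3 p :=
  keyRungGrHomLE_three_of_c11_point_sigma p hc11 hPOINT (curveSigma_of_ratioBounds p hCURVE hSUCC)

end Summit.ResolutionOfSingularities.ResolutionOfSingularities.Cruxes.HypersurfaceCentreConstruction.LocalEngine

end
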